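import Literature.NumberTheory.LFunctions.PartialEulerProducts
import Literature.NumberTheory.LFunctions.PartialEulerProductsSummation
import Literature.NumberTheory.LFunctions.PartialEulerProductsPrimeSums
import Mathlib.Analysis.SpecialFunctions.Complex.LogDeriv
import Mathlib.Analysis.Complex.LocallyUniformLimit
import Mathlib.Analysis.Complex.Convex
import HarnessLib

/-!
# Partial Euler products: the logarithm of `L(s)` on `Re s > 1/2` under Conrad's hypothesis

Topic `Literature/NumberTheory/LFunctions` (trunk T-ANT). The analytic core of Goldfeld's
theorem in the `O(1)`-form of K. Conrad, *Partial Euler products on the critical line*, Canad. J.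
Math. **57** (2005), proof of Thm. 5.3 (p. 279): for a normalized datum `α` of degree `≤ d`
over `ℚ` (`Literature.NumberTheory.LFunctions.PartialEulerProducts`) write
`c_p(s) = ∑_j -log(1 - α_{p,j} p^{-s})` and `D_x(s) = ∑_{p ≤ x} c_p(s)` (the double sum (3.1),
`logPartialProduct α s x`, whose exponential is the partial Euler product `∏_{p ≤ x} L_p(s)`).

**Theorem** (`exists_logLimit_of_isBoundedUnder`). *If `D_x(1/2) + r log log x` is bounded as
`x → ∞` for some real `r`, then there is a holomorphic function `F` on `Re s > 1/2` such that
`D_N(s) → F(s)` locally uniformly on `Re s > 1/2` (hence `D_x(s) → F(s)` for every such `s`), and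
`F(1/2 + u) - r log u` is bounded for `u ∈ (0, 1/2]`.*

Conrad's Thm. 5.3 assumes the sharper `∑_{p^k ≤ x} … = -r log log x + C' + o(1)` for the single
sum and obtains `log L(1/2 + u) = r log u + rγ + C' + o(1)`; the `O(1)`-version above for the
double sum is what the BSD fact `Literature.NumberTheory.EllipticCurves.analyticRank_eq_of_isEquivalent_prod` needs (it does not
state Goldfeld's constant `√2 e^{rγ}`), and it needs neither the second-moment hypothesis nor
Lemma 3.1. Proof (this file): decompose `c_p(s) = p^{-w} a_p - r p^{-(s+1/2)} + E_p(s)`,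
`w = s - 1/2`, `a_p = c_p(1/2) + r/p` (Part 0); the partial sums of `a_p` are bounded by
the hypothesis and Mertens' `∑_{p ≤ x} 1/p = log log x + O(1)` (`…PrimeSums`, M2), so
`∑_p a_p p^{-w}` converges locally uniformly on `Re w > 0` with `‖∑_p a_p p^{-u}‖ ≤ 2M` for real
`u > 0` (Abel summation, `…Summation`); `∑_p p^{-(s+1/2)}` and `∑_p E_p(s)` converge absolutely
and locally uniformly (`‖E_p(s)‖ ≤ d(p^{-1-δ} + 3p^{-3/2})`), and at `s = 1/2 + u`:
`-r ∑_p p^{-1-u} = r log u + O(1)` (M1) and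
`‖∑_p E_p(1/2+u)‖ ≤ d(∑_p (p^{-1-u} - p^{-1-2u})/2 + 3 ∑_p p^{-3/2}) = O(1)` (M1 twice).
Holomorphy of `F` is Weierstrass' theorem (Mathlib's
`TendstoLocallyUniformlyOn.differentiableOn`). No definitions are introduced. [folklore]

## References

* K. Conrad, *Partial Euler products on the critical line*, Canad. J. Math. 57 (2005) 267–297,
  Thm. 5.3 and its proof, Lemma 3.2, Lemma 5.1. [cite: Conrad2005PartialEuler]
* D. Goldfeld, *Sur les produits partiels eulériens attachés aux courbes elliptiques*, C. R.
  Acad. Sci. Paris Sér. I 294 (1982) 471–474. [cite: Goldfeld1982]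

## Part 0 (the error term `E_p(s)`; was planned as a separate file `…PartialEulerProductsErrorTerm`)


Topic `Literature/NumberTheory/LFunctions` (trunk T-ANT). Second layer of the proved part of
the decomposition of Goldfeld's theorem (K. Conrad, *Partial Euler products on the critical
line*, Canad. J. Math. **57** (2005), §3 and proof of Thm. 5.3), for a normalized datum
`α : ℕ → Fin d → ℂ` (`Literature.NumberTheory.LFunctions.PartialEulerProducts`).

Write `c_p(s) = ∑_j -log(1 - α_{p,j} p^{-s})` (`logEulerFactor α s p`) and `w = s - 1/2`. The
comparison of the double sum `∑_{p ≤ x} c_p(s)` (Conrad's (3.1)) on `Re s > 1/2` with its value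
on the critical line rests on the identity (per `j`, with `z₀ = α_{p,j} p^{-1/2}`, `q = p^{-w}`,
`z₀ q = α_{p,j} p^{-s}`)

  `-log(1 - z₀ q) + q log(1 - z₀) = (z₀²/2)(q² - q) + T(z₀ q) - q T(z₀)`,

`T(z) = -log(1-z) - z - z²/2` being the third Taylor remainder (
`‖T(z)‖ ≤ (4/3) ‖z‖³` for `‖z‖ ≤ 3/4`, from Mathlib's `Complex.norm_log_sub_logTaylor_le`). Hence
the *error term* `E_p(s) = c_p(s) - c_p(1/2) p^{-w}` satisfies

* `‖E_p(s)‖ ≤ d (p^{-1} ‖q² - q‖/2 + (8/3) p^{-3/2})` for `Re s ≥ 1/2` (`norm_errTerm_le`);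
* `‖E_p(s)‖ ≤ d (p^{-1-δ} + 3 p^{-3/2})` for `Re s ≥ 1/2 + δ`, `δ ≥ 0`
  (`norm_errTerm_le_of_le_re`) — summable over `p` when `δ > 0`;
* `‖E_p(1/2 + u)‖ ≤ d ((p^{-1-u} - p^{-1-2u})/2 + 3 p^{-3/2})` for real `u > 0`
  (`norm_errTerm_half_add_le`) — whose sum over `p` is `O(1)` uniformly in `u` by
  `∑_p p^{-1-u} = log(1/u) + O(1)` (this is where Conrad's constant `√2` of Thm. 1.1 hides:
  `∑_p (p^{-1-u} - p^{-1-2u}) → log 2`).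

The file also records the decomposition `c_p(s) = p^{-w} a_p + (-r p^{-(s+1/2)}) + E_p(s)` with
`a_p = c_p(1/2) + r/p` (`logEulerFactor_eq_decomp`), the corresponding
identity for `logPartialProduct` at natural arguments (`logPartialProduct_natCast_eq_sum_range`),
and the holomorphy of each partial sum `s ↦ ∑_{p ≤ x} c_p(s)` on `Re s > 0`
(`differentiableOn_logPartialProduct`). Everything here is proved, and the file introduces no
definitions: `T`, `E_p`, `a_p` are written out in full in every statement. [folklore]

## References

* K. Conrad, *Partial Euler products on the critical line*, Canad. J. Math. 57 (2005) 267–297,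
  §3 (3.1)–(3.2), proof of Lemma 3.1, proof of Thm. 5.3. [cite: Conrad2005PartialEuler]

## Part II: nonvanishing on `Re s > 1/2` and the order at `s = 1/2`


Topic `Literature/NumberTheory/LFunctions` (trunk T-ANT). The conclusion of K. Conrad's
Theorem 5.3 (*Partial Euler products on the critical line*, Canad. J. Math. **57** (2005),
p. 279) in `O(1)`-form, for a normalized datum `α` of degree `≤ d` over `ℚ`
(`Literature.NumberTheory.LFunctions.PartialEulerProducts`):

**Theorem** (`ne_zero_and_analyticOrderAt_eq_of_isBoundedUnder`). *Suppose
`∑_{p ≤ x} ∑_j -log(1 - α_{p,j}/√p) + r log log x` is bounded as `x → ∞` (`r` real), and let `G`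
be holomorphic on `Re s > 1/2` with `∏_{p ≤ x} ∏_j (1 - α_{p,j} p^{-s})⁻¹ → G(s)` as `x → ∞` for
every `s` with `Re s > 1` (i.e. `G` extends the Euler product `L(s)`). Then `G(s) ≠ 0` for
`Re s > 1/2`, and if `G` is holomorphic at `s = 1/2` then its order of vanishing there is `r`
(in particular `r` is a natural number).* This is "`L(s)` extends to a holomorphic nonvanishing
function on `Re(s) > 1/2` … If `L(s)` is holomorphic at `s = 1/2`, then the order of vanishing
there is `r`" of Thm. 5.3, without the asymptotic `L(s) ∼ e^{C'} e^{rγ} (s - 1/2)^r`, which needs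
the `o(1)`-hypothesis (5.1).

Proof: with `F` from `exists_logLimit_of_isBoundedUnder` (`…PartialEulerProductsProofs`),
`exp F = G` on `Re s > 1` (the partial products are `exp` of the double sums), hence on
`Re s > 1/2` by the identity theorem, so `G ≠ 0` there; and `‖G(1/2 + u)‖ = exp Re F(1/2+u)`
lies between `e^{-B} u^r` and `e^{B} u^r` for `u ∈ (0, 1/2]`, while an analytic `G` of order `m`
at `1/2` has `‖G(1/2 + u)‖ ≍ u^m`; so `m = r`. No definitions are introduced. [folklore]

## References

* K. Conrad, *Partial Euler products on the critical line*, Canad. J. Math. 57 (2005) 267–297,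
  Thm. 5.3. [cite: Conrad2005PartialEuler]
-/

noncomputable section

open scoped Topology
open Filter Finset Complex

namespace Literature.NumberTheory.LFunctions

namespace PartialEuler

variable {d : ℕ}

/-! ### The third Taylor remainder of `-log(1 - z)` -/

/-- `‖T(z)‖ ≤ (4/3) ‖z‖³` for `‖z‖ ≤ 3/4`, `T(z) = -log(1-z) - z - z²/2` the third-order Taylor
remainder of `-log(1-z)` (Mathlib's `Complex.norm_log_sub_logTaylor_le` with `n = 2`:
`‖log(1+z) - logTaylor 3 z‖ ≤ ‖z‖³ (1 - ‖z‖)⁻¹ / 3`). [folklore] -/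
theorem norm_logRem_le {z : ℂ} (hz : ‖z‖ ≤ 3 / 4) :
    ‖-log (1 - z) - z - z ^ 2 / 2‖ ≤ 4 / 3 * ‖z‖ ^ 3 := by
  have hz1 : ‖-z‖ < 1 := by rw [norm_neg]; linarith
  have h := norm_log_sub_logTaylor_le 2 hz1
  have hT : logTaylor 3 (-z) = -z - z ^ 2 / 2 := by
    simp [logTaylor_succ, logTaylor_zero]
    ring
  have hrem : log (1 + -z) - logTaylor 3 (-z) = -(-log (1 - z) - z - z ^ 2 / 2) := by
    rw [hT, ← sub_eq_add_neg]
    ring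
  rw [hrem, norm_neg, norm_neg] at h
  refine h.trans ?_
  have hinv : (1 - ‖z‖)⁻¹ ≤ 4 := by
    have := inv_anti₀ (show (0 : ℝ) < 1 / 4 by norm_num) (show 1 / 4 ≤ 1 - ‖z‖ by linarith)
    norm_num at this
    exact this
  have h3 : 0 ≤ ‖z‖ ^ (2 + 1) := by positivity
  calc ‖z‖ ^ (2 + 1) * (1 - ‖z‖)⁻¹ / (2 + 1) ≤ ‖z‖ ^ (2 + 1) * 4 / (2 + 1) := by
        gcongr
    _ = 4 / 3 * ‖z‖ ^ 3 := by ring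

/-- The algebraic identity behind the error term: for any `z₀, q`,
`-log(1 - z₀ q) - (-log(1 - z₀)) q = (z₀²/2)(q² - q) + (T(z₀ q) - T(z₀) q)`. [folklore] -/
theorem neg_log_sub_neg_log_mul_eq (z₀ q : ℂ) :
    -log (1 - z₀ * q) - -log (1 - z₀) * q =
      z₀ ^ 2 / 2 * (q ^ 2 - q) +
        ((-log (1 - z₀ * q) - z₀ * q - (z₀ * q) ^ 2 / 2) -
          (-log (1 - z₀) - z₀ - z₀ ^ 2 / 2) * q) := by
  ring

/-- Norm form of the identity: if `‖z₀‖ ≤ ρ ≤ 3/4` and `‖q‖ ≤ 1` then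
`‖-log(1 - z₀ q) + q log(1 - z₀)‖ ≤ ρ²/2 ‖q² - q‖ + (8/3) ρ³`. [folklore] -/
theorem norm_neg_log_sub_neg_log_mul_le {z₀ q : ℂ} {ρ : ℝ} (hz : ‖z₀‖ ≤ ρ) (hρ : ρ ≤ 3 / 4)
    (hq : ‖q‖ ≤ 1) :
    ‖-log (1 - z₀ * q) - -log (1 - z₀) * q‖ ≤ ρ ^ 2 / 2 * ‖q ^ 2 - q‖ + 8 / 3 * ρ ^ 3 := by
  have hρ0 : 0 ≤ ρ := (norm_nonneg _).trans hz
  have hzq : ‖z₀ * q‖ ≤ ρ := by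
    rw [norm_mul]
    calc ‖z₀‖ * ‖q‖ ≤ ρ * 1 := mul_le_mul hz hq (norm_nonneg _) hρ0
      _ = ρ := mul_one ρ
  rw [neg_log_sub_neg_log_mul_eq]
  refine (norm_add_le _ _).trans (add_le_add ?_ ?_)
  · rw [norm_mul, norm_div, norm_pow, Complex.norm_two]
    gcongr
  · refine (norm_sub_le _ _).trans ?_
    have h1 : ‖-log (1 - z₀ * q) - z₀ * q - (z₀ * q) ^ 2 / 2‖ ≤ 4 / 3 * ρ ^ 3 :=
      (norm_logRem_le (hzq.trans hρ)).trans (by gcongr)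
    have h2 : ‖(-log (1 - z₀) - z₀ - z₀ ^ 2 / 2) * q‖ ≤ 4 / 3 * ρ ^ 3 := by
      rw [norm_mul]
      calc ‖-log (1 - z₀) - z₀ - z₀ ^ 2 / 2‖ * ‖q‖ ≤ 4 / 3 * ρ ^ 3 * 1 :=
            mul_le_mul ((norm_logRem_le (hz.trans hρ)).trans (by gcongr)) hq (norm_nonneg _)
              (by positivity)
        _ = 4 / 3 * ρ ^ 3 := mul_one _
    linarith

/-! ### The error term `E_p(s) = c_p(s) - c_p(1/2) p^{-(s - 1/2)}` -/

/-! In what follows the *error term* is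
`E_p(s) = logEulerFactor α s p - logEulerFactor α (1/2) p * p^{-(s - 1/2)}`, written out. -/

/-- `2^{-1/2} ≤ 3/4`. [folklore] -/
theorem two_rpow_neg_half_le : (2 : ℝ) ^ (-(1 / 2 : ℝ)) ≤ 3 / 4 := by
  rw [Real.rpow_neg (by norm_num), ← Real.sqrt_eq_rpow]
  have h : (4 / 3 : ℝ) ≤ Real.sqrt 2 := Real.le_sqrt_of_sq_le (by norm_num)
  have := inv_anti₀ (by norm_num : (0 : ℝ) < 4 / 3) h
  norm_num at this
  exact this

/-- For a prime `p`: `p^{-1/2} ≤ 3/4`. [folklore] -/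
theorem prime_rpow_neg_half_le {p : ℕ} (hp : p.Prime) : (p : ℝ) ^ (-(1 / 2 : ℝ)) ≤ 3 / 4 :=
  (prime_rpow_neg_le_two_rpow_neg hp (by norm_num)).trans two_rpow_neg_half_le

/-- `p^{-s} = p^{-1/2} p^{-(s - 1/2)}`. [folklore] -/
theorem natCast_cpow_neg_eq_half_mul {p : ℕ} (hp : p ≠ 0) (s : ℂ) :
    (p : ℂ) ^ (-s) = (p : ℂ) ^ (-(1 / 2 : ℂ)) * (p : ℂ) ^ (-(s - 1 / 2)) := by
  rw [← cpow_add _ _ (Nat.cast_ne_zero.mpr hp)]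
  ring_nf

/-- `‖p^{-(s - 1/2)}‖ ≤ 1` for `Re s ≥ 1/2`. [folklore] -/
theorem norm_cpow_neg_sub_half_le_one {p : ℕ} (hp : p.Prime) {s : ℂ} (hs : 1 / 2 ≤ s.re) :
    ‖(p : ℂ) ^ (-(s - 1 / 2))‖ ≤ 1 := by
  rw [norm_natCast_cpow_neg hp.pos]
  refine Real.rpow_le_one_of_one_le_of_nonpos (by exact_mod_cast hp.one_lt.le) ?_
  have : (s - 1 / 2).re = s.re - 1 / 2 := by simp
  rw [this]
  linarith

/-- **Error term bound, general form** (`Re s ≥ 1/2`): with `q = p^{-(s-1/2)}`,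
`‖E_p(s)‖ ≤ d (p^{-1}/2 ‖q² - q‖ + (8/3) p^{-3/2})`. [folklore] -/
theorem norm_errTerm_le {α : ℕ → Fin d → ℂ} (hα : IsNormalized α) {p : ℕ} (hp : p.Prime)
    {s : ℂ} (hs : 1 / 2 ≤ s.re) :
    ‖logEulerFactor α s p - logEulerFactor α (1 / 2) p * (p : ℂ) ^ (-(s - 1 / 2))‖ ≤
      d * ((p : ℝ) ^ (-1 : ℝ) / 2 *
      ‖((p : ℂ) ^ (-(s - 1 / 2))) ^ 2 - (p : ℂ) ^ (-(s - 1 / 2))‖ +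
        8 / 3 * (p : ℝ) ^ (-(3 / 2 : ℝ))) := by
  set q : ℂ := (p : ℂ) ^ (-(s - 1 / 2)) with hq
  set ρ : ℝ := (p : ℝ) ^ (-(1 / 2 : ℝ)) with hρ
  have hp0 : (0 : ℝ) < p := by exact_mod_cast hp.pos
  have hρ2 : ρ ^ 2 = (p : ℝ) ^ (-1 : ℝ) := by
    rw [hρ, ← Real.rpow_natCast, ← Real.rpow_mul hp0.le]; norm_num
  have hρ3 : ρ ^ 3 = (p : ℝ) ^ (-(3 / 2 : ℝ)) := by
    rw [hρ, ← Real.rpow_natCast, ← Real.rpow_mul hp0.le]; norm_num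
  have hqn : ‖q‖ ≤ 1 := norm_cpow_neg_sub_half_le_one hp hs
  have hz : ∀ j, ‖α p j * (p : ℂ) ^ (-(1 / 2 : ℂ))‖ ≤ ρ := by
    intro j
    have := norm_mul_cpow_neg_le hα hp j (1 / 2)
    convert this using 2
    norm_num [hρ]
  -- rewrite `E_p(s)` as a sum over `j`
  have hE : logEulerFactor α s p - logEulerFactor α (1 / 2) p * q =
      ∑ j, (-log (1 - α p j * (p : ℂ) ^ (-(1 / 2 : ℂ)) * q) -
        -log (1 - α p j * (p : ℂ) ^ (-(1 / 2 : ℂ))) * q) := by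
    rw [logEulerFactor, logEulerFactor, Finset.sum_mul, ← Finset.sum_sub_distrib]
    refine Finset.sum_congr rfl fun j _ => ?_
    rw [natCast_cpow_neg_eq_half_mul hp.ne_zero s, mul_assoc]
  rw [hE]
  refine (norm_sum_le _ _).trans ?_
  calc ∑ j, ‖-log (1 - α p j * (p : ℂ) ^ (-(1 / 2 : ℂ)) * q) -
          -log (1 - α p j * (p : ℂ) ^ (-(1 / 2 : ℂ))) * q‖
      ≤ ∑ _j : Fin d, (ρ ^ 2 / 2 * ‖q ^ 2 - q‖ + 8 / 3 * ρ ^ 3) :=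
        Finset.sum_le_sum fun j _ =>
          norm_neg_log_sub_neg_log_mul_le (hz j) (prime_rpow_neg_half_le hp) hqn
    _ = d * (ρ ^ 2 / 2 * ‖q ^ 2 - q‖ + 8 / 3 * ρ ^ 3) := by
        rw [Finset.sum_const, Finset.card_univ, Fintype.card_fin, nsmul_eq_mul]
    _ = _ := by rw [hρ2, hρ3]

/-- **Error term bound on `Re s ≥ 1/2 + δ`** (`δ ≥ 0`): `‖E_p(s)‖ ≤ d (p^{-1-δ} + 3 p^{-3/2})`,
using `‖q² - q‖ ≤ 2 ‖q‖ ≤ 2 p^{-δ}`. [folklore] -/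
theorem norm_errTerm_le_of_le_re {α : ℕ → Fin d → ℂ} (hα : IsNormalized α) {p : ℕ}
    (hp : p.Prime) {δ : ℝ} (hδ : 0 ≤ δ) {s : ℂ} (hs : 1 / 2 + δ ≤ s.re) :
    ‖logEulerFactor α s p - logEulerFactor α (1 / 2) p * (p : ℂ) ^ (-(s - 1 / 2))‖ ≤
      d * ((p : ℝ) ^ (-1 - δ) + 3 * (p : ℝ) ^ (-(3 / 2 : ℝ))) := by
  have hp0 : (0 : ℝ) < p := by exact_mod_cast hp.pos
  have hp1 : (1 : ℝ) ≤ p := by exact_mod_cast hp.one_lt.le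
  refine (norm_errTerm_le hα hp (by linarith)).trans ?_
  have hqn : ‖(p : ℂ) ^ (-(s - 1 / 2))‖ ≤ (p : ℝ) ^ (-δ) := by
    rw [norm_natCast_cpow_neg hp.pos]
    refine Real.rpow_le_rpow_of_exponent_le hp1 ?_
    have : (s - 1 / 2).re = s.re - 1 / 2 := by simp
    rw [this]; linarith
  have hq1 : ‖(p : ℂ) ^ (-(s - 1 / 2))‖ ≤ 1 := norm_cpow_neg_sub_half_le_one hp (by linarith)
  have hdiff : ‖((p : ℂ) ^ (-(s - 1 / 2))) ^ 2 - (p : ℂ) ^ (-(s - 1 / 2))‖ ≤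
      2 * (p : ℝ) ^ (-δ) := by
    refine (norm_sub_le _ _).trans ?_
    rw [norm_pow]
    nlinarith [norm_nonneg ((p : ℂ) ^ (-(s - 1 / 2)))]
  have hmain : (p : ℝ) ^ (-1 : ℝ) / 2 * ‖((p : ℂ) ^ (-(s - 1 / 2))) ^ 2 - (p : ℂ) ^ (-(s - 1 / 2))‖
      ≤ (p : ℝ) ^ (-1 - δ) := by
    calc (p : ℝ) ^ (-1 : ℝ) / 2 * ‖((p : ℂ) ^ (-(s - 1 / 2))) ^ 2 - (p : ℂ) ^ (-(s - 1 / 2))‖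
        ≤ (p : ℝ) ^ (-1 : ℝ) / 2 * (2 * (p : ℝ) ^ (-δ)) := by gcongr
      _ = (p : ℝ) ^ (-1 : ℝ) * (p : ℝ) ^ (-δ) := by ring
      _ = (p : ℝ) ^ (-1 - δ) := by rw [← Real.rpow_add hp0]; ring_nf
  have h83 : 8 / 3 * (p : ℝ) ^ (-(3 / 2 : ℝ)) ≤ 3 * (p : ℝ) ^ (-(3 / 2 : ℝ)) := by
    have : 0 ≤ (p : ℝ) ^ (-(3 / 2 : ℝ)) := by positivity
    nlinarith
  have hd : (0 : ℝ) ≤ d := Nat.cast_nonneg d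
  calc (d : ℝ) * ((p : ℝ) ^ (-1 : ℝ) / 2 *
        ‖((p : ℂ) ^ (-(s - 1 / 2))) ^ 2 - (p : ℂ) ^ (-(s - 1 / 2))‖ + 8 / 3 * (p : ℝ) ^ (-(3 / 2 : ℝ)))
      ≤ d * ((p : ℝ) ^ (-1 - δ) + 3 * (p : ℝ) ^ (-(3 / 2 : ℝ))) :=
        mul_le_mul_of_nonneg_left (add_le_add hmain h83) hd

/-- For real `u` and a prime `p`: `p^{-((1/2 + u) - 1/2)} = p^{-u}` is the real number `p^{-u}`.
[folklore] -/
theorem natCast_cpow_neg_half_add_sub_half {p : ℕ} (u : ℝ) :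
    (p : ℂ) ^ (-(((1 / 2 : ℂ) + u) - 1 / 2)) = (((p : ℝ) ^ (-u) : ℝ) : ℂ) := by
  have : -(((1 / 2 : ℂ) + u) - 1 / 2) = ((-u : ℝ) : ℂ) := by push_cast; ring
  rw [this, show (p : ℂ) = ((p : ℝ) : ℂ) by simp, ← ofReal_cpow (Nat.cast_nonneg p)]

/-- **Error term bound at `s = 1/2 + u`, `u > 0` real:**
`‖E_p(1/2+u)‖ ≤ d ((p^{-1-u} - p^{-1-2u})/2 + 3 p^{-3/2})`, using that `q = p^{-u} ∈ (0, 1]` is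
real so that `‖q² - q‖ = q - q²`. [folklore] -/
theorem norm_errTerm_half_add_le {α : ℕ → Fin d → ℂ} (hα : IsNormalized α) {p : ℕ}
    (hp : p.Prime) {u : ℝ} (hu : 0 < u) :
    ‖logEulerFactor α ((1 / 2 : ℂ) + u) p -
        logEulerFactor α (1 / 2) p * (p : ℂ) ^ (-(((1 / 2 : ℂ) + u) - 1 / 2))‖ ≤
      d * (((p : ℝ) ^ (-1 - u) - (p : ℝ) ^ (-1 - 2 * u)) / 2 + 3 * (p : ℝ) ^ (-(3 / 2 : ℝ))) := by
  have hp0 : (0 : ℝ) < p := by exact_mod_cast hp.pos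
  have hp1 : (1 : ℝ) ≤ p := by exact_mod_cast hp.one_lt.le
  have hs : 1 / 2 ≤ ((1 / 2 : ℂ) + u).re := by simp [hu.le]
  refine (norm_errTerm_le hα hp hs).trans ?_
  rw [natCast_cpow_neg_half_add_sub_half]
  set q : ℝ := (p : ℝ) ^ (-u) with hq
  have hq0 : 0 ≤ q := by positivity
  have hq1 : q ≤ 1 := Real.rpow_le_one_of_one_le_of_nonpos hp1 (by linarith)
  have hdiff : ‖((q : ℂ)) ^ 2 - (q : ℂ)‖ = q - q ^ 2 := by
    have : ((q : ℂ)) ^ 2 - (q : ℂ) = ((q ^ 2 - q : ℝ) : ℂ) := by push_cast; ring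
    rw [this, norm_real, Real.norm_eq_abs, abs_of_nonpos (by nlinarith), neg_sub]
  rw [hdiff]
  have hq2 : q ^ 2 = (p : ℝ) ^ (-(2 * u)) := by
    rw [hq, ← Real.rpow_natCast, ← Real.rpow_mul hp0.le]; ring_nf
  have hmain : (p : ℝ) ^ (-1 : ℝ) / 2 * (q - q ^ 2) =
      ((p : ℝ) ^ (-1 - u) - (p : ℝ) ^ (-1 - 2 * u)) / 2 := by
    rw [hq2, hq, show (-1 - u : ℝ) = -1 + -u by ring, show (-1 - 2 * u : ℝ) = -1 + -(2 * u) by ring,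
      Real.rpow_add hp0, Real.rpow_add hp0]
    ring
  rw [hmain]
  have h83 : 8 / 3 * (p : ℝ) ^ (-(3 / 2 : ℝ)) ≤ 3 * (p : ℝ) ^ (-(3 / 2 : ℝ)) := by
    have : 0 ≤ (p : ℝ) ^ (-(3 / 2 : ℝ)) := by positivity
    nlinarith
  have hd : (0 : ℝ) ≤ d := Nat.cast_nonneg d
  gcongr

/-! ### The decomposition `c_p(s) = p^{-w} a_p - r p^{-(s+1/2)} + E_p(s)`

With `a_n = c_n(1/2) + r/n` for `n` prime (`0` otherwise) — the sequence whose partial sums are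
bounded under Conrad's hypothesis `∑_{p ≤ x} c_p(1/2) = -r log log x + O(1)` and Mertens'
theorem — the three `ℕ`-indexed sequences `n^{-(s-1/2)} a_n`, `-r n^{-(s+1/2)}` and `E_n(s)`
(each supported on the primes) add up to `[n prime] c_n(s)`. -/

section Decomposition

variable (α : ℕ → Fin d → ℂ) (r : ℝ)

/-- `p^{-(s-1/2)} / p = p^{-(s+1/2)}`. [folklore] -/
theorem cpow_neg_sub_half_div {p : ℕ} (hp : p ≠ 0) (s : ℂ) :
    (p : ℂ) ^ (-(s - 1 / 2)) / p = (p : ℂ) ^ (-(s + 1 / 2)) := by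
  have hp' : (p : ℂ) ≠ 0 := Nat.cast_ne_zero.mpr hp
  rw [div_eq_mul_inv, ← cpow_neg_one, ← cpow_add _ _ hp']
  ring_nf

/-- **The decomposition** at a prime `p`:
`c_p(s) = p^{-(s-1/2)} (c_p(1/2) + r/p) + (-r p^{-(s+1/2)}) + E_p(s)`. [folklore] -/
theorem logEulerFactor_eq_decomp {p : ℕ} (hp : p.Prime) (s : ℂ) :
    logEulerFactor α s p =
      (p : ℂ) ^ (-(s - 1 / 2)) * (logEulerFactor α (1 / 2) p + r / p) +
        -(r : ℂ) * (p : ℂ) ^ (-(s + 1 / 2)) +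
        (logEulerFactor α s p - logEulerFactor α (1 / 2) p * (p : ℂ) ^ (-(s - 1 / 2))) := by
  rw [← cpow_neg_sub_half_div hp.ne_zero s]
  ring

/-- The decomposition with the prime indicator: for every `n`,
`[n prime] c_n(s) = n^{-(s-1/2)} a_n + [n prime](-r n^{-(s+1/2)}) + [n prime] E_n(s)`.
[folklore] -/
theorem ite_logEulerFactor_eq_decomp (s : ℂ) (n : ℕ) :
    (if n.Prime then logEulerFactor α s n else 0) =
      (n : ℂ) ^ (-(s - 1 / 2)) * (if n.Prime then logEulerFactor α (1 / 2) n + r / n else 0) +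
        (if n.Prime then -(r : ℂ) * (n : ℂ) ^ (-(s + 1 / 2)) else 0) +
        (if n.Prime then
        logEulerFactor α s n - logEulerFactor α (1 / 2) n * (n : ℂ) ^ (-(s - 1 / 2)) else 0) := by
  by_cases hn : n.Prime
  · simp only [if_pos hn]
    exact logEulerFactor_eq_decomp α r hn s
  · simp [hn]

/-- `Nat.primesLE ⌊N⌋₊ = (range (N+1)).filter Prime` at a natural number `N`. [folklore] -/
theorem primesLE_natCast (N : ℕ) :
    Nat.primesLE ⌊(N : ℝ)⌋₊ = (Finset.range (N + 1)).filter Nat.Prime := by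
  rw [Nat.floor_natCast]
  rfl

/-- The double sum at a natural argument as a sum over `range (N+1)` with the prime indicator.
[folklore] -/
theorem logPartialProduct_natCast (s : ℂ) (N : ℕ) :
    logPartialProduct α s N = ∑ n ∈ Finset.range (N + 1),
      if n.Prime then logEulerFactor α s n else 0 := by
  rw [logPartialProduct, primesLE_natCast, Finset.sum_filter]

/-- **The double sum decomposed:** `∑_{p ≤ N} c_p(s) = ∑_{n ≤ N} n^{-(s-1/2)} a_n
+ ∑_{n ≤ N} [n prime](-r n^{-(s+1/2)}) + ∑_{n ≤ N} [n prime] E_n(s)`. [folklore] -/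
theorem logPartialProduct_natCast_eq_sum_range (s : ℂ) (N : ℕ) :
    logPartialProduct α s N =
      ∑ n ∈ Finset.range (N + 1), (n : ℂ) ^ (-(s - 1 / 2)) * (if n.Prime then logEulerFactor α (1 / 2) n + r / n else 0) +
      ∑ n ∈ Finset.range (N + 1), (if n.Prime then -(r : ℂ) * (n : ℂ) ^ (-(s + 1 / 2)) else 0) +
      ∑ n ∈ Finset.range (N + 1), (if n.Prime then
        logEulerFactor α s n - logEulerFactor α (1 / 2) n * (n : ℂ) ^ (-(s - 1 / 2)) else 0) := by
  rw [logPartialProduct_natCast, ← Finset.sum_add_distrib, ← Finset.sum_add_distrib]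
  exact Finset.sum_congr rfl fun n _ => ite_logEulerFactor_eq_decomp α r s n

/-- The partial sums of `a`: `∑_{n ≤ N} a_n = ∑_{p ≤ N} c_p(1/2) + r ∑_{p ≤ N} 1/p`. [folklore] -/
theorem sum_range_succ_aSeq (N : ℕ) :
    ∑ n ∈ Finset.range (N + 1), (if n.Prime then logEulerFactor α (1 / 2) n + r / n else 0) =
      logPartialProduct α (1 / 2) N +
        r * ((∑ p ∈ (Finset.Iic N).filter Nat.Prime, (1 : ℝ) / p : ℝ) : ℂ) := by
  have hIic : (Finset.Iic N).filter Nat.Prime = (Finset.range (N + 1)).filter Nat.Prime := by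
    ext p; simp
  rw [logPartialProduct_natCast, hIic, ofReal_sum, Finset.mul_sum, Finset.sum_filter,
    ← Finset.sum_add_distrib]
  refine Finset.sum_congr rfl fun n _ => ?_
  by_cases hn : n.Prime
  · rw [if_pos hn, if_pos hn, if_pos hn]
    push_cast
    ring
  · simp [hn]

end Decomposition

/-! ### The double sum only depends on `⌊x⌋`, and is holomorphic in `s` -/

/-- `logPartialProduct α s x = logPartialProduct α s ⌊x⌋₊`. [folklore] -/
theorem logPartialProduct_eq_floor (α : ℕ → Fin d → ℂ) (s : ℂ) (x : ℝ) :
    logPartialProduct α s x = logPartialProduct α s (⌊x⌋₊ : ℝ) := by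
  simp only [logPartialProduct, Nat.floor_natCast]

/-- `partialProduct α s x = partialProduct α s ⌊x⌋₊`. [folklore] -/
theorem partialProduct_eq_floor (α : ℕ → Fin d → ℂ) (s : ℂ) (x : ℝ) :
    partialProduct α s x = partialProduct α s (⌊x⌋₊ : ℝ) := by
  simp only [partialProduct, Nat.floor_natCast]

/-- Each Euler factor logarithm `s ↦ c_p(s)` is holomorphic on `Re s > 0` (there
`1 - α_{p,j} p^{-s}` lies in the slit plane). [folklore] -/
theorem differentiableOn_logEulerFactor {α : ℕ → Fin d → ℂ} (hα : IsNormalized α) {p : ℕ}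
    (hp : p.Prime) : DifferentiableOn ℂ (fun s => logEulerFactor α s p) {s : ℂ | 0 < s.re} := by
  intro s hs
  have hcpow : DifferentiableAt ℂ (fun s : ℂ => (p : ℂ) ^ (-s)) s :=
    differentiableAt_id.neg.const_cpow (Or.inl (Nat.cast_ne_zero.mpr hp.ne_zero))
  refine DifferentiableAt.differentiableWithinAt ?_
  unfold logEulerFactor
  refine DifferentiableAt.fun_sum fun j _ => ?_
  refine ((hcpow.const_mul (α p j)).const_sub 1).clog ?_ |>.neg
  rw [sub_eq_add_neg]
  exact mem_slitPlane_of_norm_lt_one (by rw [norm_neg]; exact norm_mul_cpow_neg_lt_one hα hp j hs)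

/-- The double sum `s ↦ ∑_{p ≤ x} c_p(s)` is holomorphic on `Re s > 0`. [folklore] -/
theorem differentiableOn_logPartialProduct {α : ℕ → Fin d → ℂ} (hα : IsNormalized α) (x : ℝ) :
    DifferentiableOn ℂ (fun s => logPartialProduct α s x) {s : ℂ | 0 < s.re} := by
  unfold logPartialProduct
  refine DifferentiableOn.fun_sum fun p hp => ?_
  exact differentiableOn_logEulerFactor hα (Nat.prime_of_mem_primesLE hp)

end PartialEuler

end Literature.NumberTheory.LFunctions

end

noncomputable section

open scoped Topology
open Filter Finset Complex Metric

namespace Literature.NumberTheory.LFunctions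

namespace PartialEuler

variable {d : ℕ} {α : ℕ → Fin d → ℂ}

/-! ### Small tools -/

/-- An eventually bounded sequence in a normed group is bounded. [folklore] -/
theorem exists_forall_norm_le_of_eventually {E : Type*} [SeminormedAddCommGroup E] {f : ℕ → E}
    {C : ℝ} (h : ∀ᶠ N in atTop, ‖f N‖ ≤ C) : ∃ M : ℝ, ∀ N, ‖f N‖ ≤ M := by
  obtain ⟨N₀, hN₀⟩ := eventually_atTop.mp h
  refine ⟨max C (∑ N ∈ range N₀, ‖f N‖), fun N => ?_⟩
  by_cases hN : N₀ ≤ N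
  · exact (hN₀ N hN).trans (le_max_left _ _)
  · push Not at hN
    refine le_trans ?_ (le_max_right _ _)
    exact Finset.single_le_sum (f := fun N => ‖f N‖) (fun _ _ => norm_nonneg _)
      (Finset.mem_range.mpr hN)

/-- Index change in a uniform convergence statement: if `F n → f` uniformly on `s` along `p`
and `g → p` along `p'`, then `F (g m) → f` uniformly on `s` along `p'`. [folklore] -/
theorem tendstoUniformlyOn_comp_index {ι ι' X Y : Type*} [UniformSpace Y] {F : ι → X → Y}
    {f : X → Y} {p : Filter ι} {s : Set X} (h : TendstoUniformlyOn F f p s) {g : ι' → ι}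
    {p' : Filter ι'} (hg : Tendsto g p' p) : TendstoUniformlyOn (fun m => F (g m)) f p' s :=
  fun u hu => hg.eventually (h u hu)

/-- A compact subset of the half-plane `Re s > 1/2` lies in a half-strip
`{δ ≤ Re(s - 1/2), ‖s - 1/2‖ ≤ R}` with `δ > 0`. [folklore] -/
theorem exists_strip_of_isCompact {K : Set ℂ} (hK : IsCompact K) (hKΩ : K ⊆ {s : ℂ | 1 / 2 < s.re}) :
    ∃ δ R : ℝ, 0 < δ ∧ K ⊆ {s : ℂ | δ ≤ (s - 1 / 2).re ∧ ‖s - 1 / 2‖ ≤ R} := by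
  rcases K.eq_empty_or_nonempty with rfl | hne
  · exact ⟨1, 0, one_pos, by simp⟩
  obtain ⟨s₀, hs₀K, hs₀⟩ := hK.exists_isMinOn hne continuous_re.continuousOn
  obtain ⟨s₁, hs₁K, hs₁⟩ :=
    hK.exists_isMaxOn hne (continuous_norm.comp (continuous_id.sub continuous_const)).continuousOn
  refine ⟨s₀.re - 1 / 2, ‖s₁ - 1 / 2‖, by have := hKΩ hs₀K; simp at this; linarith, fun s hs => ?_⟩
  refine ⟨?_, hs₁ hs⟩
  have := hs₀ hs
  simp only [sub_re, one_div] at this ⊢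
  norm_num at this ⊢
  linarith

/-- `HasSum` over the primes versus `HasSum` over `ℕ` of the prime-indicator sequence. [folklore] -/
theorem hasSum_ite_prime_iff {E : Type*} [AddCommMonoid E] [TopologicalSpace E] {f : ℕ → E}
    {a : E} : HasSum (fun n : ℕ => if n.Prime then f n else 0) a ↔
      HasSum (fun p : Nat.Primes => f p) a := by
  have h : (fun n : ℕ => if n.Prime then f n else 0) = {n : ℕ | n.Prime}.indicator f := by
    funext n
    by_cases hn : n.Prime
    · rw [if_pos hn, Set.indicator_of_mem (by exact hn)]
    · rw [if_neg hn, Set.indicator_of_notMem (by exact hn)]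
  rw [h, ← hasSum_subtype_iff_indicator]
  exact Iff.rfl

/-! ### Bounded partial sums of `a_p = c_p(1/2) + r/p` -/

/-- **Bounded partial sums.** Under Conrad's hypothesis in `O(1)`-form — `D_x(1/2) + r log log x`
bounded as `x → ∞` — the partial sums `∑_{n<N} a_n`, `a_p = c_p(1/2) + r/p` (`0` off the
primes), are bounded: `∑_{p ≤ N} a_p = (D_N(1/2) + r log log N) + r (∑_{p ≤ N} 1/p - log log N)`
and Mertens' theorem (M2). [cite: Conrad2005PartialEuler, proof of Thm. 5.3] -/
theorem exists_norm_sum_range_aSeq_le (α : ℕ → Fin d → ℂ) {r : ℝ}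
    (hH : IsBoundedUnder (· ≤ ·) atTop
      fun x : ℝ => ‖logPartialProduct α (1 / 2) x + r * Real.log (Real.log x)‖) :
    ∃ M : ℝ, ∀ N, ‖∑ n ∈ range N,
      (if n.Prime then logEulerFactor α (1 / 2) n + r / n else 0)‖ ≤ M := by
  obtain ⟨C, hC⟩ := hH
  rw [eventually_map] at hC
  obtain ⟨C₂, hC₂⟩ := exists_abs_sum_filter_prime_Iic_inv_sub_loglog_le
  have hCN : ∀ᶠ N : ℕ in atTop,
      ‖logPartialProduct α (1 / 2) N + r * Real.log (Real.log N)‖ ≤ C := hC.natCast_atTop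
  -- bound at `N + 1`
  have h1 : ∀ᶠ N : ℕ in atTop, ‖∑ n ∈ range (N + 1),
      (if n.Prime then logEulerFactor α (1 / 2) n + r / n else 0)‖ ≤ C + |r| * C₂ := by
    filter_upwards [hCN, eventually_ge_atTop 2] with N hN hN2
    rw [sum_range_succ_aSeq]
    have h2 := hC₂ N hN2
    set S : ℝ := ∑ p ∈ (Finset.Iic N).filter Nat.Prime, (1 : ℝ) / p with hS
    calc ‖logPartialProduct α (1 / 2) N + r * (S : ℂ)‖
        = ‖(logPartialProduct α (1 / 2) N + r * Real.log (Real.log N)) +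
            r * ((S - Real.log (Real.log N) : ℝ) : ℂ)‖ := by
          congr 1; push_cast; ring
      _ ≤ ‖logPartialProduct α (1 / 2) N + r * Real.log (Real.log N)‖ +
            ‖(r : ℂ) * ((S - Real.log (Real.log N) : ℝ) : ℂ)‖ := norm_add_le _ _
      _ ≤ C + |r| * C₂ := by
          gcongr
          rw [norm_mul, norm_real, norm_real, Real.norm_eq_abs, Real.norm_eq_abs]
          exact mul_le_mul_of_nonneg_left h2 (abs_nonneg r)
  -- shift the index
  have h2 : ∀ᶠ K : ℕ in atTop, ‖∑ n ∈ range K,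
      (if n.Prime then logEulerFactor α (1 / 2) n + r / n else 0)‖ ≤ C + |r| * C₂ := by
    obtain ⟨N₀, hN₀⟩ := eventually_atTop.mp h1
    refine eventually_atTop.mpr ⟨N₀ + 1, fun K hK => ?_⟩
    have := hN₀ (K - 1) (by omega)
    rwa [Nat.sub_add_cancel (by omega)] at this
  exact exists_forall_norm_le_of_eventually h2

/-! ### The theorem -/

/-- **The logarithm of `L(s)` on `Re s > 1/2` under Conrad's hypothesis** (the `O(1)`-form of
Conrad 2005, Thm. 5.3, for the double sum; see the module docstring). Let `α` be normalized of
degree `≤ d` and suppose `‖∑_{p ≤ x} ∑_j -log(1 - α_{p,j}/√p) + r log log x‖` is bounded as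
`x → ∞` for some real `r`. Then there is `F : ℂ → ℂ`, holomorphic on `Re s > 1/2`, such that
the double sums `s ↦ ∑_{p ≤ N} ∑_j -log(1 - α_{p,j} p^{-s})` converge to `F` locally uniformly on
`Re s > 1/2` as `N → ∞` (so `∑_{p ≤ x} … → F(s)` as the real `x → ∞`, for each such `s`), and
`‖F(1/2 + u) - r log u‖` is bounded for `u ∈ (0, 1/2]`.
[cite: Conrad2005PartialEuler, Thm. 5.3 (proof, p. 279)] -/
theorem exists_logLimit_of_isBoundedUnder (hα : IsNormalized α) {r : ℝ}
    (hH : IsBoundedUnder (· ≤ ·) atTop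
      fun x : ℝ => ‖logPartialProduct α (1 / 2) x + r * Real.log (Real.log x)‖) :
    ∃ F : ℂ → ℂ, DifferentiableOn ℂ F {s : ℂ | 1 / 2 < s.re} ∧
      TendstoLocallyUniformlyOn (fun (N : ℕ) (s : ℂ) => logPartialProduct α s N) F atTop
        {s : ℂ | 1 / 2 < s.re} ∧
      (∀ s : ℂ, 1 / 2 < s.re → Tendsto (fun x : ℝ => logPartialProduct α s x) atTop (𝓝 (F s))) ∧
      ∃ B : ℝ, ∀ u ∈ Set.Ioc (0 : ℝ) (1 / 2), ‖F (1 / 2 + u) - r * Real.log u‖ ≤ B := by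
  have hΩ : IsOpen {s : ℂ | 1 / 2 < s.re} := isOpen_lt continuous_const continuous_re
  obtain ⟨M, hA⟩ := exists_norm_sum_range_aSeq_le α hH
  have hM : 0 ≤ M := (norm_nonneg _).trans (hA 0)
  -- the sequence `a` and the three pieces of the limit
  set a : ℕ → ℂ := fun n => if n.Prime then logEulerFactor α (1 / 2) n + r / n else 0 with ha
  set T : ℂ → ℂ := fun w => -∑' i : ℕ,
    ((((i + 1 : ℕ) : ℂ) ^ (-w)) - (i : ℂ) ^ (-w)) * ∑ n ∈ range (i + 1), a n with hT
  set P : ℂ → ℂ := fun s => ∑' n : ℕ,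
    (if n.Prime then -(r : ℂ) * (n : ℂ) ^ (-(s + 1 / 2)) else 0) with hP
  set E : ℂ → ℂ := fun s => ∑' n : ℕ, (if n.Prime then
    logEulerFactor α s n - logEulerFactor α (1 / 2) n * (n : ℂ) ^ (-(s - 1 / 2)) else 0) with hE
  set F : ℂ → ℂ := fun s => T (s - 1 / 2) + P s + E s with hF
  -- summable majorants
  have hsumP : ∀ {δ : ℝ}, 0 < δ → Summable fun n : ℕ => |r| * (n : ℝ) ^ (-1 - δ) := fun hδ =>
    (Real.summable_nat_rpow.mpr (by linarith)).mul_left |r|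
  have hsumE : ∀ {δ : ℝ}, 0 < δ →
      Summable fun n : ℕ => (d : ℝ) * ((n : ℝ) ^ (-1 - δ) + 3 * (n : ℝ) ^ (-(3 / 2 : ℝ))) :=
    fun hδ => ((Real.summable_nat_rpow.mpr (by linarith)).add
      ((Real.summable_nat_rpow.mpr (by norm_num)).mul_left 3)).mul_left (d : ℝ)
  -- Step 1: uniform convergence on half-strips
  have hstrip : ∀ {δ : ℝ}, 0 < δ → ∀ R : ℝ,
      TendstoUniformlyOn (fun (N : ℕ) (s : ℂ) => logPartialProduct α s N) F atTop
        {s : ℂ | δ ≤ (s - 1 / 2).re ∧ ‖s - 1 / 2‖ ≤ R} := by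
    intro δ hδ R
    set S : Set ℂ := {s : ℂ | δ ≤ (s - 1 / 2).re ∧ ‖s - 1 / 2‖ ≤ R} with hS
    have hSre : ∀ s ∈ S, 1 / 2 + δ ≤ s.re := by
      intro s hs
      have := hs.1
      simp only [sub_re, one_div] at this
      norm_num at this
      linarith
    -- (T1) Abel summation, composed with `s ↦ s - 1/2`
    have h1 : TendstoUniformlyOn (fun (N : ℕ) (s : ℂ) => ∑ n ∈ range N,
        (n : ℂ) ^ (-(s - 1 / 2)) * a n) (fun s => T (s - 1 / 2)) atTop S :=
      (tendstoUniformlyOn_sum_range_cpow_mul hA hδ R).comp (fun s : ℂ => s - 1 / 2)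
    -- (T2) the prime Dirichlet series, M-test
    have h2 : TendstoUniformlyOn (fun (N : ℕ) (s : ℂ) => ∑ n ∈ range N,
        (if n.Prime then -(r : ℂ) * (n : ℂ) ^ (-(s + 1 / 2)) else 0)) P atTop S := by
      refine tendstoUniformlyOn_tsum_nat (hsumP hδ) fun n s hs => ?_
      by_cases hn : n.Prime
      · rw [if_pos hn, norm_mul, norm_neg, norm_real, Real.norm_eq_abs,
          norm_natCast_cpow_of_pos hn.pos]
        refine mul_le_mul_of_nonneg_left ?_ (abs_nonneg r)
        refine Real.rpow_le_rpow_of_exponent_le (by exact_mod_cast hn.one_lt.le) ?_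
        have := hSre s hs
        simp only [neg_re, add_re, one_div]
        norm_num
        linarith
      · rw [if_neg hn, norm_zero]
        positivity
    -- (T3) the error terms, M-test
    have h3 : TendstoUniformlyOn (fun (N : ℕ) (s : ℂ) => ∑ n ∈ range N, (if n.Prime then
        logEulerFactor α s n - logEulerFactor α (1 / 2) n * (n : ℂ) ^ (-(s - 1 / 2)) else 0))
        E atTop S := by
      refine tendstoUniformlyOn_tsum_nat (hsumE hδ) fun n s hs => ?_
      by_cases hn : n.Prime
      · rw [if_pos hn]
        exact norm_errTerm_le_of_le_re hα hn hδ.le (hSre s hs)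
      · rw [if_neg hn, norm_zero]
        positivity
    have h123 := tendstoUniformlyOn_comp_index ((h1.add h2).add h3) (tendsto_add_atTop_nat 1)
    refine h123.congr (Eventually.of_forall fun N s _ => ?_)
    simp only [Pi.add_apply]
    exact (logPartialProduct_natCast_eq_sum_range α r s N).symm
  -- Step 2: locally uniform convergence and holomorphy
  have hloc : TendstoLocallyUniformlyOn (fun (N : ℕ) (s : ℂ) => logPartialProduct α s N) F atTop
      {s : ℂ | 1 / 2 < s.re} := by
    rw [tendstoLocallyUniformlyOn_iff_forall_isCompact hΩ]
    intro K hKΩ hK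
    obtain ⟨δ, R, hδ, hKS⟩ := exists_strip_of_isCompact hK hKΩ
    exact (hstrip hδ R).mono hKS
  have hdiff : DifferentiableOn ℂ F {s : ℂ | 1 / 2 < s.re} :=
    hloc.differentiableOn (Eventually.of_forall fun N =>
      (differentiableOn_logPartialProduct hα (N : ℝ)).mono fun s hs => by
        simp only [Set.mem_setOf_eq] at hs ⊢; linarith) hΩ
  -- Step 3: pointwise convergence along the reals
  have hpt : ∀ s : ℂ, 1 / 2 < s.re →
      Tendsto (fun x : ℝ => logPartialProduct α s x) atTop (𝓝 (F s)) := by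
    intro s hs
    have h := (hloc.tendsto_at hs).comp (tendsto_nat_floor_atTop (α := ℝ))
    refine h.congr fun x => ?_
    simp only [Function.comp_apply]
    exact (logPartialProduct_eq_floor α s x).symm
  -- Step 4: the boundary estimate
  have hbd : ∃ B : ℝ, ∀ u ∈ Set.Ioc (0 : ℝ) (1 / 2), ‖F (1 / 2 + u) - r * Real.log u‖ ≤ B := by
    obtain ⟨M₁, hM₁⟩ := exists_abs_tsum_primes_rpow_add_log_le
    set Z : ℝ := ∑' p : Nat.Primes, ((p : ℕ) : ℝ) ^ (-(3 / 2 : ℝ)) with hZ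
    refine ⟨2 * M + |r| * M₁ + d * ((2 * M₁ + Real.log 2) / 2 + 3 * Z), fun u hu => ?_⟩
    have hu0 : 0 < u := hu.1
    have hu1 : u ∈ Set.Ioc (0 : ℝ) 1 := ⟨hu.1, by linarith [hu.2]⟩
    have h2u : 2 * u ∈ Set.Ioc (0 : ℝ) 1 := ⟨by linarith [hu.1], by linarith [hu.2]⟩
    -- the prime sums `S₁ = ∑_p p^{-1-u}`, `S₂ = ∑_p p^{-1-2u}`
    set S₁ : ℝ := ∑' p : Nat.Primes, ((p : ℕ) : ℝ) ^ (-(1 + u)) with hS₁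
    set S₂ : ℝ := ∑' p : Nat.Primes, ((p : ℕ) : ℝ) ^ (-(1 + 2 * u)) with hS₂
    have hsum1 : Summable fun p : Nat.Primes => ((p : ℕ) : ℝ) ^ (-(1 + u)) :=
      Nat.Primes.summable_rpow.2 (by linarith)
    have hsum2 : Summable fun p : Nat.Primes => ((p : ℕ) : ℝ) ^ (-(1 + 2 * u)) :=
      Nat.Primes.summable_rpow.2 (by linarith)
    have hsumZ : Summable fun p : Nat.Primes => ((p : ℕ) : ℝ) ^ (-(3 / 2 : ℝ)) :=
      Nat.Primes.summable_rpow.2 (by norm_num)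
    have hS₁M : |S₁ + Real.log u| ≤ M₁ := hM₁ u hu1
    have hS₂M : |S₂ + Real.log (2 * u)| ≤ M₁ := hM₁ (2 * u) h2u
    have hlog2 : Real.log (2 * u) = Real.log 2 + Real.log u :=
      Real.log_mul (by norm_num) hu0.ne'
    have hdiffS : S₁ - S₂ ≤ 2 * M₁ + Real.log 2 := by
      have e : S₁ - S₂ = (S₁ + Real.log u) - (S₂ + Real.log (2 * u)) + Real.log 2 := by
        rw [hlog2]; ring
      rw [e]
      linarith [(abs_le.mp hS₁M).2, (abs_le.mp hS₂M).1]
    -- the argument `1/2 + u`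
    set s : ℂ := 1 / 2 + u with hs
    have hsw : s - 1 / 2 = (u : ℂ) := by rw [hs]; ring
    -- (T) Abel sum
    have hTu : ‖T (s - 1 / 2)‖ ≤ 2 * M := by
      rw [hsw]
      exact norm_abelSum_ofReal_le hA hu0
    -- (P) the prime Dirichlet series at `1/2 + u`
    have hPu : P s = -(r : ℂ) * (S₁ : ℂ) := by
      have hterm : ∀ n : ℕ, (if n.Prime then -(r : ℂ) * (n : ℂ) ^ (-(s + 1 / 2)) else 0) =
          (if n.Prime then -(r : ℂ) * ((((n : ℝ) ^ (-(1 + u)) : ℝ) : ℂ)) else 0) := by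
        intro n
        by_cases hn : n.Prime
        · rw [if_pos hn, if_pos hn]
          congr 1
          have : -(s + 1 / 2) = ((-(1 + u) : ℝ) : ℂ) := by rw [hs]; push_cast; ring
          rw [this, show (n : ℂ) = ((n : ℝ) : ℂ) by simp, ← ofReal_cpow (Nat.cast_nonneg n)]
        · rw [if_neg hn, if_neg hn]
      have hPs : P s = ∑' n : ℕ,
          (if n.Prime then -(r : ℂ) * ((((n : ℝ) ^ (-(1 + u)) : ℝ) : ℂ)) else 0) := by
        simp only [hP]
        exact tsum_congr hterm
      rw [hPs, hS₁, ofReal_tsum, ← tsum_mul_left]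
      have hhs : HasSum (fun p : Nat.Primes => -(r : ℂ) * ((((p : ℕ) : ℝ) ^ (-(1 + u)) : ℝ) : ℂ))
          (∑' p : Nat.Primes, -(r : ℂ) * ((((p : ℕ) : ℝ) ^ (-(1 + u)) : ℝ) : ℂ)) := by
        exact ((hasSum_ofReal.mpr hsum1.hasSum).summable.mul_left _).hasSum
      exact (hasSum_ite_prime_iff.mpr hhs).tsum_eq
    -- (E) the error terms at `1/2 + u`
    have hEu : ‖E s‖ ≤ d * ((S₁ - S₂) / 2 + 3 * Z) := by
      have hg : HasSum (fun n : ℕ => if n.Prime then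
          (d : ℝ) * ((((n : ℝ) ^ (-1 - u) - (n : ℝ) ^ (-1 - 2 * u)) / 2 + 3 * (n : ℝ) ^ (-(3 / 2 : ℝ))))
          else 0) (d * ((S₁ - S₂) / 2 + 3 * Z)) := by
        rw [hasSum_ite_prime_iff]
        have h := ((hsum1.hasSum.sub hsum2.hasSum).div_const 2).add (hsumZ.hasSum.mul_left 3)
        have h' := h.mul_left (d : ℝ)
        have hfun : (fun p : Nat.Primes => (d : ℝ) * (((((p : ℕ) : ℝ) ^ (-1 - u) -
            ((p : ℕ) : ℝ) ^ (-1 - 2 * u)) / 2 + 3 * ((p : ℕ) : ℝ) ^ (-(3 / 2 : ℝ))))) =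
            fun p : Nat.Primes => (d : ℝ) * ((((p : ℕ) : ℝ) ^ (-(1 + u)) -
              ((p : ℕ) : ℝ) ^ (-(1 + 2 * u))) / 2 + 3 * ((p : ℕ) : ℝ) ^ (-(3 / 2 : ℝ))) := by
          funext p
          rw [show (-1 - u : ℝ) = -(1 + u) by ring, show (-1 - 2 * u : ℝ) = -(1 + 2 * u) by ring]
        rw [hfun]
        exact h'
      refine tsum_of_norm_bounded hg fun n => ?_
      by_cases hn : n.Prime
      · rw [if_pos hn, if_pos hn, hs]
        exact norm_errTerm_half_add_le hα hn hu0
      · rw [if_neg hn, if_neg hn, norm_zero]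
    -- combine
    have hFs : F s = T (s - 1 / 2) + P s + E s := rfl
    have hkey : F s - r * Real.log u = T (s - 1 / 2) + (-(r : ℂ) * ((S₁ + Real.log u : ℝ) : ℂ)) + E s := by
      rw [hFs, hPu]; push_cast; ring
    rw [hkey]
    have hPn : ‖-(r : ℂ) * ((S₁ + Real.log u : ℝ) : ℂ)‖ ≤ |r| * M₁ := by
      rw [norm_mul, norm_neg, norm_real, norm_real, Real.norm_eq_abs, Real.norm_eq_abs]
      exact mul_le_mul_of_nonneg_left hS₁M (abs_nonneg r)
    have hd : (0 : ℝ) ≤ d := Nat.cast_nonneg d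
    have hEn : ‖E s‖ ≤ d * ((2 * M₁ + Real.log 2) / 2 + 3 * Z) :=
      hEu.trans (by gcongr)
    calc ‖T (s - 1 / 2) + -(r : ℂ) * ((S₁ + Real.log u : ℝ) : ℂ) + E s‖
        ≤ ‖T (s - 1 / 2)‖ + ‖-(r : ℂ) * ((S₁ + Real.log u : ℝ) : ℂ)‖ + ‖E s‖ := norm_add₃_le
      _ ≤ 2 * M + |r| * M₁ + d * ((2 * M₁ + Real.log 2) / 2 + 3 * Z) := by
          gcongr
  exact ⟨F, hdiff, hloc, hpt, hbd⟩

end PartialEuler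

end Literature.NumberTheory.LFunctions

end

noncomputable section

open scoped Topology
open Filter Finset Complex Metric

namespace Literature.NumberTheory.LFunctions

namespace PartialEuler

variable {d : ℕ} {α : ℕ → Fin d → ℂ}

/-- Pulling a germ at `1/2` back to the right half-line: if `P` holds near `1/2` in `ℂ`, then
`P (1/2 + u)` holds for real `u → 0⁺`. [folklore] -/
theorem eventually_nhdsGT_of_eventually_nhds {P : ℂ → Prop}
    (h : ∀ᶠ z in 𝓝 (1 / 2 : ℂ), P z) : ∀ᶠ u : ℝ in 𝓝[>] 0, P (1 / 2 + u) := by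
  have ht : Tendsto (fun u : ℝ => (1 / 2 : ℂ) + u) (𝓝[>] 0) (𝓝 (1 / 2 : ℂ)) := by
    have : Tendsto (fun u : ℝ => (1 / 2 : ℂ) + u) (𝓝 0) (𝓝 ((1 / 2 : ℂ) + (0 : ℝ))) :=
      (continuous_const.add continuous_ofReal).tendsto 0
    simp only [ofReal_zero, add_zero] at this
    exact this.mono_left nhdsWithin_le_nhds
  exact ht.eventually h

/-- For `0 < ε`: `u^ε → 0` as `u → 0⁺`. [folklore] -/
theorem tendsto_rpow_nhdsGT_zero {ε : ℝ} (hε : 0 < ε) :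
    Tendsto (fun u : ℝ => u ^ ε) (𝓝[>] 0) (𝓝 0) := by
  have h := (Real.continuousAt_rpow_const 0 ε (Or.inr hε.le)).tendsto
  rw [Real.zero_rpow hε.ne'] at h
  exact h.mono_left nhdsWithin_le_nhds

/-- **Nonvanishing on `Re s > 1/2` and the order at `1/2`** (Conrad 2005, Thm. 5.3, in
`O(1)`-form; see the module docstring). Let `α` be normalized of degree `≤ d`, let `r` be real
with `‖∑_{p ≤ x} ∑_j -log(1 - α_{p,j} p^{-1/2}) + r log log x‖` bounded as `x → ∞`, and let
`G : ℂ → ℂ` be complex differentiable on `Re s > 1/2` with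
`∏_{p ≤ x} ∏_j (1 - α_{p,j} p^{-s})⁻¹ → G(s)` (`x → ∞`) whenever `Re s > 1`. Then
(i) `G(s) ≠ 0` for every `s` with `Re s > 1/2`; (ii) if `G` is analytic at `1/2`, the order of
vanishing of `G` at `1/2` is a natural number `m` with `m = r`.
[cite: Conrad2005PartialEuler, Thm. 5.3] -/
theorem ne_zero_and_analyticOrderAt_eq_of_isBoundedUnder (hα : IsNormalized α) {r : ℝ}
    (hH : IsBoundedUnder (· ≤ ·) atTop
      fun x : ℝ => ‖logPartialProduct α (1 / 2) x + r * Real.log (Real.log x)‖)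
    {G : ℂ → ℂ} (hGd : DifferentiableOn ℂ G {s : ℂ | 1 / 2 < s.re})
    (hGlim : ∀ s : ℂ, 1 < s.re → Tendsto (fun x : ℝ => partialProduct α s x) atTop (𝓝 (G s))) :
    (∀ s : ℂ, 1 / 2 < s.re → G s ≠ 0) ∧
      (AnalyticAt ℂ G (1 / 2) → ∃ m : ℕ, analyticOrderAt G (1 / 2) = m ∧ (m : ℝ) = r) := by
  have hΩ : IsOpen {s : ℂ | 1 / 2 < s.re} := isOpen_lt continuous_const continuous_re
  obtain ⟨F, hFd, -, hpt, B, hB⟩ := exists_logLimit_of_isBoundedUnder hα hH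
  -- Step 1: `exp F = G` on `Re s > 1`
  have h1 : ∀ s : ℂ, 1 < s.re → G s = exp (F s) := by
    intro s hs
    have hlim : Tendsto (fun x : ℝ => partialProduct α s x) atTop (𝓝 (exp (F s))) := by
      have := ((continuous_exp.tendsto _).comp (hpt s (by linarith)))
      refine this.congr fun x => ?_
      simp only [Function.comp_apply]
      exact exp_logPartialProduct hα (by linarith) x
    exact tendsto_nhds_unique (hGlim s hs) hlim
  -- Step 2: identity theorem on the half-plane
  have h2 : Set.EqOn G (fun s => exp (F s)) {s : ℂ | 1 / 2 < s.re} := by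
    have hGa : AnalyticOnNhd ℂ G {s : ℂ | 1 / 2 < s.re} := hGd.analyticOnNhd hΩ
    have hEa : AnalyticOnNhd ℂ (fun s => exp (F s)) {s : ℂ | 1 / 2 < s.re} :=
      (hFd.cexp).analyticOnNhd hΩ
    refine hGa.eqOn_of_preconnected_of_eventuallyEq hEa
      (convex_halfSpace_re_gt (1 / 2)).isPreconnected (z₀ := 2) (by norm_num) ?_
    have hO : IsOpen {s : ℂ | 1 < s.re} := isOpen_lt continuous_const continuous_re
    filter_upwards [hO.mem_nhds (show (1 : ℝ) < (2 : ℂ).re by simp)] with s hs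
    exact h1 s hs
  have hne : ∀ s : ℂ, 1 / 2 < s.re → G s ≠ 0 := fun s hs => by
    rw [h2 hs]
    exact exp_ne_zero _
  refine ⟨hne, fun hGan => ?_⟩
  -- Step 3: the order at `1/2`
  -- (a) two-sided bound `e^{-B} u^r ≤ ‖G(1/2+u)‖ ≤ e^{B} u^r` on `(0, 1/2]`
  have hGu : ∀ u ∈ Set.Ioc (0 : ℝ) (1 / 2),
      Real.exp (-B) * u ^ r ≤ ‖G (1 / 2 + u)‖ ∧ ‖G (1 / 2 + u)‖ ≤ Real.exp B * u ^ r := by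
    intro u hu
    have hu0 : 0 < u := hu.1
    have hmem : (1 / 2 : ℂ) + u ∈ {s : ℂ | 1 / 2 < s.re} := by simp [hu0]
    rw [h2 hmem, norm_exp]
    have hb := hB u hu
    have hre : |(F (1 / 2 + u)).re - r * Real.log u| ≤ B := by
      have := abs_re_le_norm (F (1 / 2 + u) - r * Real.log u)
      simp only [sub_re] at this
      have h' : ((r : ℂ) * (Real.log u : ℂ)).re = r * Real.log u := by
        rw [← ofReal_mul, ofReal_re]
      rw [h'] at this
      exact this.trans hb
    have hur : u ^ r = Real.exp (r * Real.log u) := by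
      rw [Real.rpow_def_of_pos hu0, mul_comm]
    rw [hur, ← Real.exp_add, ← Real.exp_add]
    constructor
    · exact Real.exp_le_exp.mpr (by linarith [(abs_le.mp hre).1])
    · exact Real.exp_le_exp.mpr (by linarith [(abs_le.mp hre).2])
  -- (b) the order is finite
  have htop : analyticOrderAt G (1 / 2) ≠ ⊤ := by
    intro htop
    rw [analyticOrderAt_eq_top] at htop
    have hev := eventually_nhdsGT_of_eventually_nhds htop
    have hev' : ∀ᶠ u : ℝ in 𝓝[>] 0, G (1 / 2 + u) ≠ 0 := by
      filter_upwards [self_mem_nhdsWithin] with u hu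
      exact hne _ (by simp [Set.mem_Ioi.mp hu])
    obtain ⟨u, hu1, hu2⟩ := (hev.and hev').exists
    exact hu2 hu1
  obtain ⟨m, hm⟩ := ENat.ne_top_iff_exists.mp htop
  refine ⟨m, hm.symm, ?_⟩
  -- (c) local form `G z = (z - 1/2)^m g z`
  obtain ⟨g, hga, hg0, hgev⟩ := (hGan.analyticOrderAt_eq_natCast).mp hm.symm
  set c : ℝ := ‖g (1 / 2)‖ with hc
  have hcpos : 0 < c := norm_pos_iff.mpr hg0
  -- `‖g(1/2 + u)‖ ∈ (c/2, 2c)` for small `u > 0`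
  have hgt : Tendsto (fun u : ℝ => ‖g (1 / 2 + u)‖) (𝓝[>] 0) (𝓝 c) := by
    have h := (continuous_norm.tendsto _).comp
      (hga.continuousAt.tendsto.comp
        (show Tendsto (fun u : ℝ => (1 / 2 : ℂ) + u) (𝓝[>] 0) (𝓝 (1 / 2 : ℂ)) from by
          have : Tendsto (fun u : ℝ => (1 / 2 : ℂ) + u) (𝓝 0) (𝓝 ((1 / 2 : ℂ) + (0 : ℝ))) :=
            (continuous_const.add continuous_ofReal).tendsto 0
          simp only [ofReal_zero, add_zero] at this
          exact this.mono_left nhdsWithin_le_nhds))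
    exact h
  have hgbd : ∀ᶠ u : ℝ in 𝓝[>] 0, c / 2 < ‖g (1 / 2 + u)‖ ∧ ‖g (1 / 2 + u)‖ < 2 * c := by
    have h1' := hgt.eventually (Ioo_mem_nhds (show c / 2 < c by linarith) (show c < 2 * c by linarith))
    filter_upwards [h1'] with u hu
    exact hu
  -- `‖G(1/2+u)‖ = u^m ‖g(1/2+u)‖` for small `u > 0`
  have hGform : ∀ᶠ u : ℝ in 𝓝[>] 0, ‖G (1 / 2 + u)‖ = u ^ m * ‖g (1 / 2 + u)‖ := by
    filter_upwards [eventually_nhdsGT_of_eventually_nhds hgev, self_mem_nhdsWithin] with u hu hu0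
    rw [hu, norm_smul, add_sub_cancel_left, norm_pow, norm_real, Real.norm_eq_abs,
      abs_of_pos (Set.mem_Ioi.mp hu0)]
  have hsmall : ∀ᶠ u : ℝ in 𝓝[>] 0, u ∈ Set.Ioc (0 : ℝ) (1 / 2) := Ioc_mem_nhdsGT one_half_pos
  -- (d) compare the two growth rates
  by_contra hmr
  rcases lt_or_gt_of_ne hmr with hlt | hgt'
  · -- `m < r`: `(c/2) e^{-B} ≤ u^{r-m} → 0`
    have hev : ∀ᶠ u : ℝ in 𝓝[>] 0, c / 2 * Real.exp (-B) ≤ u ^ (r - m) := by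
      filter_upwards [hgbd, hGform, hsmall, self_mem_nhdsWithin] with u hg hG hu hu0
      have hu0' : 0 < u := Set.mem_Ioi.mp hu0
      have hup := (hGu u hu).2
      rw [hG] at hup
      -- `u^m (c/2) ≤ u^m ‖g‖ ≤ e^B u^r`
      have h3 : u ^ m * (c / 2) ≤ Real.exp B * u ^ r :=
        le_trans (mul_le_mul_of_nonneg_left hg.1.le (by positivity)) hup
      have hum : 0 < u ^ (m : ℝ) := Real.rpow_pos_of_pos hu0' _
      rw [Real.rpow_sub hu0', Real.rpow_natCast, le_div_iff₀ (by positivity)]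
      calc c / 2 * Real.exp (-B) * u ^ m = Real.exp (-B) * (u ^ m * (c / 2)) := by ring
        _ ≤ Real.exp (-B) * (Real.exp B * u ^ r) :=
            mul_le_mul_of_nonneg_left h3 (Real.exp_pos _).le
        _ = u ^ r := by rw [← mul_assoc, ← Real.exp_add, neg_add_cancel, Real.exp_zero, one_mul]
    have hlim := tendsto_rpow_nhdsGT_zero (show 0 < r - m by linarith)
    have := ge_of_tendsto hlim hev
    have : 0 < c / 2 * Real.exp (-B) := by positivity
    linarith
  · -- `r < m`: `e^{-B}/(2c) ≤ u^{m-r} → 0`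
    have hev : ∀ᶠ u : ℝ in 𝓝[>] 0, Real.exp (-B) / (2 * c) ≤ u ^ ((m : ℝ) - r) := by
      filter_upwards [hgbd, hGform, hsmall, self_mem_nhdsWithin] with u hg hG hu hu0
      have hu0' : 0 < u := Set.mem_Ioi.mp hu0
      have hlow := (hGu u hu).1
      rw [hG] at hlow
      -- `e^{-B} u^r ≤ u^m ‖g‖ ≤ u^m 2c`
      have h3 : Real.exp (-B) * u ^ r ≤ u ^ m * (2 * c) :=
        hlow.trans (mul_le_mul_of_nonneg_left hg.2.le (by positivity))
      have hur : 0 < u ^ r := Real.rpow_pos_of_pos hu0' _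
      rw [Real.rpow_sub hu0', Real.rpow_natCast, le_div_iff₀ hur, div_mul_eq_mul_div,
        div_le_iff₀ (by positivity)]
      exact h3
    have hlim := tendsto_rpow_nhdsGT_zero (show 0 < (m : ℝ) - r by linarith)
    have := ge_of_tendsto hlim hev
    have : 0 < Real.exp (-B) / (2 * c) := by positivity
    linarith

end PartialEuler

end Literature.NumberTheory.LFunctions

end
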